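import Mathlib
import HarnessLib

/-!
# Every eigensystem of a faithful commutative endomorphism algebra occurs modulo `n`

THEOREM (`exists_common_eigenvector_mod`). Let a commutative ring `A` act FAITHFULLY on a module `M`
that is finitely generated over `ℤ`, let `n ≠ 0`, and let `𝔪` be a maximal ideal of `A` containing `n`.
Then some nonzero `w ∈ M / nM` is killed by `𝔪`: the eigensystem `A → A/𝔪` OCCURS in `M / nM`
(`A` acts on `w` through `A/𝔪`, `smul_eq_smul_of_sub_mem`). General form
`exists_ne_zero_forall_smul_eq_zero` (any `p ∈ 𝔪`, `M` finite over `A`, `M/pM` finite).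

Steps: (L1) `exists_ne_zero_forall_mem_mul_eq_zero` — in a commutative Artinian ring every maximal
ideal kills a nonzero element; (L2) `annihilator_quotient_le` — `Ann_A(M/pM) ⊆ 𝔭` for every prime
`𝔭 ∋ p` (Cayley–Hamilton, using faithfulness); (L3) apply (L1) in the finite ring `A / Ann(M/pM)`.

USE (cell pub-abcsig, T6 ADMISSIBILITY gate P2.2; lit/T6-PIN.md P2.2; lead/T6-DOSSIER-g7.md): with
`A` = the Hecke ring acting on `S₂(Γ₀(N); ℤ)⁺` (faithful; = the Hecke ring of `S₂(Γ₀(N))` by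
Eichler–Shimura) and `𝔪 = ker(Φ : A → 𝔽̄_n)` the reduction of a newform's eigensystem: every
newform's mod-`n` eigensystem occurs in the mod-`n` modular-symbol space, so a θ-free mod-`n` census
misses no newform. Standard commutative algebra, PROVED here from Mathlib (axioms `propext`,
`Classical.choice`, `Quot.sound`): the inputs in print are the determinant trick
[AtiyahMacdonald1969, Prop. 2.4] with the faithful-module argument of [AtiyahMacdonald1969,
Prop. 5.1 (iv ⇒ i)], and the structure of Artin rings [AtiyahMacdonald1969, Prop. 8.4, Prop. 8.6,
Thm. 8.7]; compare the Deligne–Serre lifting lemma [DeligneSerre1974, Lemme 6.11] (the converse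
direction: a mod-`𝔪` eigenvector lifts to characteristic `0`). Honest framing: pure commutative
algebra; no statement about modular forms or ABC is made here. Author: p1 g9
(prover-pub-abcsig-p1-g9-0), venture cell `pub-abcsig`, 2026-08-23 (its `ModNEigen.lean`,
final form ee5761228a402258); carried into `Literature/` by the literature seat with statements and
proofs unchanged (citation tags only).
-/

namespace Literature.Algebra.Module

namespace ModNEigen

open Ideal

/-- In a commutative Artinian ring, every maximal ideal kills some nonzero element (the powers `𝔪^k`
stabilise, Nakayama gives `r ≡ 1 (mod 𝔪)` with `r 𝔪^k = 0`, and a minimal such `k` yields the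
element). [cite: AtiyahMacdonald1969, Prop. 8.4 and Prop. 8.6 with Thm. 8.7 (Artin rings: the maximal ideal of an Artin local ring is nilpotent) — standard consequence; proved here] -/
theorem exists_ne_zero_forall_mem_mul_eq_zero {B : Type*} [CommRing B] [IsArtinianRing B]
    (𝔪 : Ideal B) [h𝔪 : 𝔪.IsMaximal] : ∃ y : B, y ≠ 0 ∧ ∀ a ∈ 𝔪, a * y = 0 := by
  classical
  have hnt : Nontrivial B := by
    by_contra h
    rw [not_nontrivial_iff_subsingleton] at h
    exact h𝔪.ne_top (Subsingleton.elim _ _)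
  -- the chain 𝔪^k stabilises
  let f : ℕ →o (Submodule B B)ᵒᵈ := ⟨fun k => OrderDual.toDual (𝔪 ^ k), fun i j hij => by
      change 𝔪 ^ j ≤ 𝔪 ^ i
      exact Ideal.pow_le_pow_right hij⟩
  obtain ⟨k, hk⟩ := IsArtinian.monotone_stabilizes f
  have hstab : 𝔪 ^ k = 𝔪 ^ (k + 1) := by
    have := hk (k + 1) (Nat.le_succ k)
    exact OrderDual.toDual.injective this
  -- Nakayama: some r with r - 1 ∈ 𝔪 kills 𝔪^k
  have hfg : (𝔪 ^ k).FG := (IsNoetherian.noetherian (𝔪 ^ k))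
  have hle : 𝔪 ^ k ≤ 𝔪 • 𝔪 ^ k := by
    rw [Ideal.smul_eq_mul, ← pow_succ', ← hstab]
  obtain ⟨r, hr1, hr⟩ := Submodule.exists_sub_one_mem_and_smul_eq_zero_of_fg_of_le_smul 𝔪 (𝔪 ^ k) hfg hle
  have hr0 : r ∉ 𝔪 := by
    intro hr'
    have : (1 : B) ∈ 𝔪 := by
      have := 𝔪.sub_mem hr' hr1
      simpa using this
    exact h𝔪.ne_top ((Ideal.eq_top_iff_one _).mpr this)
  have hrne : r ≠ 0 := by rintro rfl; exact hr0 𝔪.zero_mem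
  -- P j : every element of 𝔪^j kills r; true at j = k
  have hP : ∃ j, ∀ x ∈ 𝔪 ^ j, x * r = 0 :=
    ⟨k, fun x hx => by rw [mul_comm]; simpa [smul_eq_mul] using hr x hx⟩
  let j := Nat.find hP
  have hj : ∀ x ∈ 𝔪 ^ j, x * r = 0 := Nat.find_spec hP
  have hj0 : j ≠ 0 := by
    intro h0
    have := hj 1 (by rw [h0, pow_zero, Ideal.one_eq_top]; exact Submodule.mem_top)
    exact hrne (by simpa using this)
  obtain ⟨j', hj'⟩ : ∃ j', j = j' + 1 := Nat.exists_eq_succ_of_ne_zero hj0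
  have hnot : ¬ ∀ x ∈ 𝔪 ^ j', x * r = 0 := Nat.find_min hP (by omega)
  push Not at hnot
  obtain ⟨x, hx, hxr⟩ := hnot
  refine ⟨x * r, hxr, fun a ha => ?_⟩
  have hax : a * x ∈ 𝔪 ^ j := by
    rw [hj', pow_succ']
    exact Ideal.mul_mem_mul ha hx
  calc a * (x * r) = (a * x) * r := by ring
    _ = 0 := hj _ hax

/-- Step L2 (Cayley–Hamilton / faithfulness): if `A` acts faithfully on a finite module `M`, then for
every `p : A` and every prime `𝔭 ∋ p`, the annihilator of `M / pM` is contained in `𝔭`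
(`u · M ⊆ p M` forces `uⁿ ∈ pA` by the determinant trick).
[cite: AtiyahMacdonald1969, Prop. 2.4 (determinant trick: φ(M) ⊆ 𝔞M ⇒ φⁿ + a₁φⁿ⁻¹ + ⋯ + aₙ = 0 with aᵢ ∈ 𝔞) and Prop. 5.1 (iv ⇒ i) (faithful module) — standard; proved here] -/
theorem annihilator_quotient_le {A : Type*} [CommRing A] {M : Type*} [AddCommGroup M] [Module A M]
    [Module.Finite A M] (hfaith : Module.annihilator A M = ⊥) (p : A) (𝔭 : Ideal A) [h𝔭 : 𝔭.IsPrime]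
    (hp : p ∈ 𝔭) :
    Module.annihilator A (M ⧸ (Ideal.span {p} • ⊤ : Submodule A M)) ≤ 𝔭 := by
  intro u hu
  rw [Module.mem_annihilator] at hu
  -- u • m ∈ p M for every m
  have hrange : LinearMap.range (algebraMap A (Module.End A M) u) ≤ (Ideal.span {p} • ⊤ : Submodule A M) := by
    rintro _ ⟨m, rfl⟩
    have := hu (Submodule.Quotient.mk m)
    rw [← Submodule.Quotient.mk_smul, Submodule.Quotient.mk_eq_zero] at this
    simpa [Module.algebraMap_end_eq_smul_id] using this
  obtain ⟨q, hmonic, hdeg, hcoeff, hq⟩ :=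
    LinearMap.exists_monic_and_natDegree_eq_and_coeff_mem_pow_and_aeval_eq_zero A
      (algebraMap A (Module.End A M) u) (Ideal.span {p}) hrange
  -- aeval u q acts as zero, hence is zero by faithfulness
  have hzero : Polynomial.aeval u q = 0 := by
    have h1 : algebraMap A (Module.End A M) (Polynomial.aeval u q) = 0 := by
      rw [← Polynomial.aeval_algebraMap_apply]; exact hq
    have : Polynomial.aeval u q ∈ Module.annihilator A M := by
      rw [Module.mem_annihilator]; intro m
      have := congrArg (fun φ : Module.End A M => φ m) h1
      simpa [Module.algebraMap_end_eq_smul_id] using this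
    rw [hfaith] at this
    exact (Submodule.mem_bot A).mp this
  -- u^n = -(lower terms) ∈ 𝔭
  set n := q.natDegree with hn
  have hsum := Polynomial.aeval_eq_sum_range (x := u) (p := q)
  rw [hzero, Finset.sum_range_succ, hmonic.coeff_natDegree, one_smul] at hsum
  have hlow : ∑ i ∈ Finset.range n, q.coeff i • u ^ i ∈ 𝔭 := by
    refine 𝔭.sum_mem fun i hi => ?_
    rw [Finset.mem_range] at hi
    have hci : q.coeff i ∈ Ideal.span {p} ^ (n - i) := hcoeff i
    have hci' : q.coeff i ∈ 𝔭 := by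
      have hle : Ideal.span {p} ^ (n - i) ≤ 𝔭 := by
        calc Ideal.span {p} ^ (n - i) ≤ Ideal.span {p} := Ideal.pow_le_self (by omega)
          _ ≤ 𝔭 := by rw [Ideal.span_singleton_le_iff_mem]; exact hp
      exact hle hci
    rw [smul_eq_mul]
    exact 𝔭.mul_mem_right _ hci'
  have hun : u ^ n ∈ 𝔭 := by
    have e : u ^ n = -(∑ i ∈ Finset.range n, q.coeff i • u ^ i) := by
      have := hsum; linear_combination -this
    rw [e]; exact 𝔭.neg_mem hlow
  exact h𝔭.mem_of_pow_mem n hun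

/-- Step L3 (**occurrence of every maximal ideal as an eigensystem**): if a commutative ring `A` acts
faithfully on a finite module `M`, `𝔪` is a maximal ideal of `A` containing `p`, and `M / pM` is a
finite set, then some nonzero `w ∈ M / pM` is killed by `𝔪` — i.e. the eigensystem `A → A/𝔪` occurs
in `M / pM`. (T6, gate P2.2: `A` = Hecke ring on `S = S₂(Γ₀(N); ℤ)⁺`, `p` = the prime `n`,
`𝔪 = ker Φ`.) [cite: AtiyahMacdonald1969, Thm. 8.7 with Prop. 8.4 (Artin rings) and Prop. 2.4 (determinant trick) — assembled; proved here] -/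
theorem exists_ne_zero_forall_smul_eq_zero {A : Type*} [CommRing A] {M : Type*} [AddCommGroup M]
    [Module A M] [Module.Finite A M] (hfaith : Module.annihilator A M = ⊥) (p : A) (𝔪 : Ideal A)
    [h𝔪 : 𝔪.IsMaximal] (hp : p ∈ 𝔪)
    [hfin : Finite (M ⧸ (Ideal.span {p} • ⊤ : Submodule A M))] :
    ∃ w : M ⧸ (Ideal.span {p} • ⊤ : Submodule A M), w ≠ 0 ∧ ∀ a ∈ 𝔪, a • w = 0 := by
  classical
  set Mb := M ⧸ (Ideal.span {p} • ⊤ : Submodule A M)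
  let φ : A →+* AddMonoid.End Mb := Module.toAddMonoidEnd A Mb
  have hker : RingHom.ker φ = Module.annihilator A Mb := rfl
  have hkerle : RingHom.ker φ ≤ 𝔪 := by
    rw [hker]; exact annihilator_quotient_le hfaith p 𝔪 hp
  -- B := A / ker φ is finite, hence Artinian
  haveI : Finite (AddMonoid.End Mb) := Finite.of_injective _ DFunLike.coe_injective
  haveI : Finite (A ⧸ RingHom.ker φ) :=
    Finite.of_injective _ (RingHom.kerLift_injective φ)
  haveI : IsArtinianRing (A ⧸ RingHom.ker φ) := isArtinian_of_finite
  -- image of 𝔪 is maximal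
  have hsurj : Function.Surjective (Ideal.Quotient.mk (RingHom.ker φ)) := Ideal.Quotient.mk_surjective
  have hmax : (𝔪.map (Ideal.Quotient.mk (RingHom.ker φ))).IsMaximal := by
    rcases Ideal.map_eq_top_or_isMaximal_of_surjective _ hsurj h𝔪 with htop | hmax
    · exfalso
      have := Ideal.comap_map_of_surjective _ hsurj 𝔪
      rw [htop, Ideal.comap_top] at this
      have hk : Ideal.comap (Ideal.Quotient.mk (RingHom.ker φ)) ⊥ = RingHom.ker φ := by
        rw [← RingHom.ker_eq_comap_bot, Ideal.mk_ker]
      rw [hk, sup_eq_left.mpr hkerle] at this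
      exact h𝔪.ne_top this.symm
    · exact hmax
  haveI := hmax
  obtain ⟨yb, hyb, hkill⟩ := exists_ne_zero_forall_mem_mul_eq_zero (𝔪.map (Ideal.Quotient.mk (RingHom.ker φ)))
  obtain ⟨y, rfl⟩ := hsurj yb
  -- y acts nontrivially on Mb
  have hy : y ∉ RingHom.ker φ := by
    intro h
    exact hyb (Ideal.Quotient.eq_zero_iff_mem.mpr h)
  have hy' : ∃ m : Mb, y • m ≠ 0 := by
    by_contra h
    push Not at h
    exact hy (by rw [hker, Module.mem_annihilator]; exact h)
  obtain ⟨m, hm⟩ := hy'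
  refine ⟨y • m, hm, fun a ha => ?_⟩
  have hay : Ideal.Quotient.mk (RingHom.ker φ) a * Ideal.Quotient.mk (RingHom.ker φ) y = 0 :=
    hkill _ (Ideal.mem_map_of_mem _ ha)
  rw [← map_mul, Ideal.Quotient.eq_zero_iff_mem, hker, Module.mem_annihilator] at hay
  rw [← mul_smul]
  exact hay m

/-- The element `w` of `exists_ne_zero_forall_smul_eq_zero` is a simultaneous eigenvector: `A` acts on
it through `A/𝔪` (`a • w = c • w` whenever `a ≡ c mod 𝔪`).
[cite: AtiyahMacdonald1969, Ch. 2 (modules annihilated by an ideal 𝔞 are A/𝔞-modules) — plumbing; proved here] -/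
theorem smul_eq_smul_of_sub_mem {A : Type*} [CommRing A] {W : Type*} [AddCommGroup W] [Module A W]
    (𝔪 : Ideal A) {w : W} (hw : ∀ a ∈ 𝔪, a • w = 0) {a c : A} (hac : a - c ∈ 𝔪) :
    a • w = c • w := by
  have := hw _ hac
  rw [sub_smul, sub_eq_zero] at this
  exact this

/-- Finiteness of `M / nM` for a module finitely generated over `ℤ` (with `n ≠ 0` acting through any
commutative ring `A`): the hypothesis `Finite (M ⧸ …)` of `exists_ne_zero_forall_smul_eq_zero` in the
T6 setting (`M = S₂(Γ₀(N); ℤ)⁺`, `n` the prime).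
[cite: Lang2002, Ch. III §7 (finitely generated modules over principal rings; `M/nM` is finite for `M` finitely generated over ℤ, `n ≠ 0`) — elementary; proved here] -/
theorem finite_quotient_natCast_smul_top {A : Type*} [CommRing A] {M : Type*} [AddCommGroup M]
    [Module A M] [Module.Finite ℤ M] (n : ℕ) (hn : n ≠ 0) :
    Finite (M ⧸ (Ideal.span {(n : A)} • ⊤ : Submodule A M)) := by
  set Q := M ⧸ (Ideal.span {(n : A)} • ⊤ : Submodule A M)
  let π : M →ₗ[ℤ] Q := ((Ideal.span {(n : A)} • ⊤ : Submodule A M).mkQ).restrictScalars ℤ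
  have hπ : Function.Surjective π := fun x => Submodule.Quotient.mk_surjective _ x
  haveI : Module.Finite ℤ Q := Module.Finite.of_surjective π hπ
  have key : ∀ x : Q, (n : ℤ) • x = 0 := by
    intro x
    obtain ⟨m, rfl⟩ := hπ x
    have hm : ((n : ℤ) • m : M) = (n : A) • m := by
      rw [natCast_zsmul, Nat.cast_smul_eq_nsmul]
    rw [← map_zsmul π, hm]
    change Submodule.Quotient.mk ((n : A) • m) = 0
    rw [Submodule.Quotient.mk_eq_zero]
    exact Submodule.smul_mem_smul (Ideal.mem_span_singleton_self _) Submodule.mem_top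
  refine Module.finite_of_fg_torsion Q fun x => ?_
  have hn' : ((n : ℤ)) ∈ nonZeroDivisors ℤ :=
    mem_nonZeroDivisors_of_ne_zero (by exact_mod_cast hn)
  exact ⟨⟨(n : ℤ), hn'⟩, key x⟩

/-- **T6 form.** A commutative ring `A` acting faithfully on a module `M` finitely generated over `ℤ`
(e.g. the Hecke ring on `S₂(Γ₀(N); ℤ)⁺`), `n ≠ 0`, `𝔪` a maximal ideal of `A` containing `n`:
some nonzero `w ∈ M / nM` is killed by `𝔪` (the eigensystem `A → A/𝔪` occurs in `M / nM`).
[cite: AtiyahMacdonald1969, Prop. 2.4, Prop. 8.4, Thm. 8.7 — assembled; proved here] (compare the converse lifting direction [cite: DeligneSerre1974, Lemme 6.11]) -/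
theorem exists_common_eigenvector_mod {A : Type*} [CommRing A] {M : Type*} [AddCommGroup M]
    [Module A M] [Module.Finite ℤ M] (hfaith : Module.annihilator A M = ⊥) (n : ℕ) (hn : n ≠ 0)
    (𝔪 : Ideal A) [𝔪.IsMaximal] (hn𝔪 : (n : A) ∈ 𝔪) :
    ∃ w : M ⧸ (Ideal.span {(n : A)} • ⊤ : Submodule A M), w ≠ 0 ∧ ∀ a ∈ 𝔪, a • w = 0 := by
  haveI : Module.Finite A M := Module.Finite.of_restrictScalars_finite ℤ A M
  haveI := finite_quotient_natCast_smul_top (A := A) (M := M) n hn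
  exact exists_ne_zero_forall_smul_eq_zero hfaith (n : A) 𝔪 hn𝔪

end ModNEigen

end Literature.Algebra.Module
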